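import Summits.Ventures.AbcSig.Rows.Bridge
import Summits.Ventures.AbcSig.Rows.C2aL193A0X
import Summits.Ventures.AbcSig.Rows.C2aL193A0XAB

/-!
# Venture AbcSig — CELL `C2aL193A0`: the census statement `Rows.C2aCellRed 193 (fun a => a = 0) ∅` from the two row theorems

HONEST FRAMING. COMPUTATION cell `pub-abcsig`; CONDITIONAL theorem; no claim on ABC or any summit. Hypotheses exactly as
in `Rows/C2aL193A0X.lean` and `Rows/C2aL193A0XAB.lean`: `BS04Package` (CITED), `DataComplete …` (COMPUTED level files), `EisPackage` (CITED) and `Refines` (COMPUTED) for the M6 orbits discharged in the kernel, and the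
rows' per-orbit exclusions for `famB` as universally quantified hypotheses (CITED: the census
row's certificates). Conclusion = p1's census predicate (`Rows/Statements.lean`), all four coprime coefficient
distributions `A·B = 2^a·193^m`, reduced exponents `a < n`, `m < n` (RULING H1). GENERATED by p-lean gen/make_rows.py
(after plean/make_cell_bridges.py).
-/

namespace Summit.Ventures.AbcSig

/-- Cell `C2aL193A0` (M6 orbits discharged in the kernel): `Rows.C2aCellRed 193 (fun a => a = 0) ∅` under the rows' hypotheses. -/
theorem xcell_C2aL193A0 (M : NewformModel) (hP : M.BS04Package)
    (hE : M.EisPackage)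
    (hD386 : M.DataComplete 386 level386Orbits)
    (hD6176 : M.DataComplete 6176 level6176Orbits)
    (hR_orbit_386_4 : M.Refines 386 orbit_386_4 m6X_386_4)
    (hX_orbit_6176_6 : ∀ n m : ℕ, n ∈ ([13] : List ℕ) → M.Excludes 6176 orbit_6176_6 (famB (2 ^ 0 * 193 ^ m) n (fun _ _ => True)))
    (hX_orbit_6176_9 : ∀ n m : ℕ, n ∈ ([23] : List ℕ) → M.Excludes 6176 orbit_6176_9 (famB (2 ^ 0 * 193 ^ m) n (fun _ _ => True))) :
    Rows.C2aCellRed 193 (fun a => a = 0) ∅ :=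
  C2aCellRed_of_rows 193 (by norm_num) (by norm_num) _ _
    (fun n hn h11 hnℓ _ a m (ha : a = 0) han hm hmn x y z h1 h2 => by
      subst ha
      exact
 xrow_C2aL193A0 M hP hE hD386 hD6176 hR_orbit_386_4 n hn h11 hnℓ m hm hmn (hX_orbit_6176_6 n m) (hX_orbit_6176_9 n m) x y z h1 h2)
    (fun n hn h11 hnℓ _ a m (ha : a = 0) han hm hmn x y z h1 h2 => by
      subst ha
      exact
 xrow_C2aL193A0AB M hP hE hD386 hD6176 hR_orbit_386_4 n hn h11 hnℓ m hm hmn (hX_orbit_6176_6 n m) (hX_orbit_6176_9 n m) x y z h1 h2)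

end Summit.Ventures.AbcSig
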